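import Summits.FinalStateConjecture.FinalStateConjecture.Theorems.EIHFluxBalanceInertialRecessionVirialNodes

/-!
# Route EIHFluxBalance — crux `InertialRecession`, abstract endgame for general `N`:
# the frozen-block hierarchy — dyadic index blocks, level separation, transported gaps, qualifying ball supersets, centres

Helper file for the crux `stmt-FinalStateConjecture-10166` (virial route; `InertialRecession_seat0_session8_note.md` §A).
Mathlib-only. The virial lemma discretises `[T, T′]` into fine steps `tₙ = T + n h` and uses, at level `ℓ = k₀ + d`, the DYADIC
INDEX BLOCKS `[2^d q, 2^d (q+1))`; the block of step `n` starts at the index `2^d (n / 2^d)`. This file proves: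

* `blockStart_le`, `lt_blockStart_add`, `blockStart_nested`, `blockStart_anti` — elementary arithmetic of the nested dyadic grids;
* `level_succ_le_of_ssubset` — a strict superset node lives at a strictly coarser level (`Λ ≥ 32`, motion `≤ 2^ℓ/16`);
* `oneGapped_transport` — a `Λ`-gapped node stays `1`-gapped after a motion `≤ g/16` per body (laminarity of the alive family);
* `ball_qualifies` — the ball superset of `exists_ball_ssuperset`, transported to its own (earlier) block start, is again `Λ`-gapped with
  a near outsider and its gap in the dyadic range of its level (the lever bound: parents are not much larger than gaps);
* `norm_centre_sub_centre_le`, `centre_singleton` — rest-mass centres of subfamilies of a set of diameter `≤ D` are within `D`.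
-/

noncomputable section

open Finset

namespace Summit.FinalStateConjecture.FinalStateConjecture.Theorems.SublinearIsFree.Virial

open Literature.Geometry.Lorentzian

/-! ### Dyadic index blocks -/

/-- The level-`d` block of `n` starts at or before `n`. [folklore] -/
theorem blockStart_le (d n : ℕ) : 2 ^ d * (n / 2 ^ d) ≤ n := Nat.mul_div_le n (2 ^ d)

/-- … and ends strictly after `n`. [folklore] -/
theorem lt_blockStart_add (d n : ℕ) : n < 2 ^ d * (n / 2 ^ d) + 2 ^ d := by
  have h := Nat.lt_mul_div_succ n (Nat.two_pow_pos d)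
  linarith [h, (Nat.mul_succ (2 ^ d) (n / 2 ^ d)).symm.le, (Nat.mul_succ (2 ^ d) (n / 2 ^ d)).le]

/-- **Nesting.** A step `n′` in the level-`d` block of `n` has the same level-`d′` block as `n` for every `d′ ≥ d`. [folklore] -/
theorem blockStart_nested {d d' n n' : ℕ} (hdd' : d ≤ d') (h1 : 2 ^ d * (n / 2 ^ d) ≤ n')
    (h2 : n' < 2 ^ d * (n / 2 ^ d) + 2 ^ d) : 2 ^ d' * (n' / 2 ^ d') = 2 ^ d' * (n / 2 ^ d') := by
  congr 1
  obtain ⟨e, rfl⟩ := Nat.exists_eq_add_of_le hdd'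
  rw [pow_add, ← Nat.div_div_eq_div_mul, ← Nat.div_div_eq_div_mul]
  congr 1
  -- `n' / 2^d = n / 2^d`
  have hpos : 0 < 2 ^ d := Nat.two_pow_pos d
  apply le_antisymm
  · -- `n' < 2^d * (n/2^d + 1)`
    have : n' / 2 ^ d < n / 2 ^ d + 1 := by
      rw [Nat.div_lt_iff_lt_mul hpos]
      linarith [h2]
    omega
  · exact (Nat.le_div_iff_mul_le hpos).mpr (by linarith [h1])

/-- Coarser blocks start earlier. [folklore] -/
theorem blockStart_anti {d d' : ℕ} (hdd' : d ≤ d') (n : ℕ) : 2 ^ d' * (n / 2 ^ d') ≤ 2 ^ d * (n / 2 ^ d) := by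
  obtain ⟨e, rfl⟩ := Nat.exists_eq_add_of_le hdd'
  rw [pow_add, ← Nat.div_div_eq_div_mul, mul_assoc]
  exact Nat.mul_le_mul_left _ (Nat.mul_div_le _ _)

/-- A step of the level-`d′` block of `n` lies in `[2^{d′}(n/2^{d′}), 2^{d′}(n/2^{d′}) + 2^{d′})`; in particular the level-`d` block start
of `n` does, for `d ≤ d′`. [folklore] -/
theorem blockStart_mem_coarser {d d' : ℕ} (hdd' : d ≤ d') (n : ℕ) :
    2 ^ d' * (n / 2 ^ d') ≤ 2 ^ d * (n / 2 ^ d) ∧ 2 ^ d * (n / 2 ^ d) < 2 ^ d' * (n / 2 ^ d') + 2 ^ d' :=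
  ⟨blockStart_anti hdd' n, (blockStart_le d n).trans_lt (lt_blockStart_add d' n)⟩

/-! ### Level separation and transported gaps -/

variable {ι : Type*} [DecidableEq ι] [Fintype ι]

/-- **A strict superset node lives at a strictly coarser level.** `B` is `(D, g)`-controlled and `Λ`-gapped in the configuration `ξ`
with `2^ℓ ≤ g`; the bodies then move by at most `μ ≤ 2^ℓ/16` to the configuration `ξ′`, in which a strict superset `B′` of `B` is
`(D′, g′)`-controlled and `Λ`-gapped with `g′ < 2^{ℓ′+3}`. If `Λ ≥ 32` then `ℓ + 1 ≤ ℓ′`. [folklore] -/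
theorem level_succ_le_of_ssubset {ξ ξ' : ι → E3} {μ : ℝ} (hμ : ∀ x, ‖ξ' x - ξ x‖ ≤ μ) {B B' : Finset ι} {D g D' g' Λ : ℝ}
    {ℓ ℓ' : ℕ} (hΛ : 32 ≤ Λ) (hB : B.Nonempty) (hBB' : B ⊂ B')
    (hD : ∀ x ∈ B, ∀ y ∈ B, ‖ξ x - ξ y‖ ≤ D) (hg : ∀ x ∈ B, ∀ z ∈ univ \ B, g ≤ ‖ξ x - ξ z‖)
    (hℓ : (2 : ℝ) ^ ℓ ≤ g) (hμℓ : μ ≤ (2 : ℝ) ^ ℓ / 16)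
    (hD' : ∀ x ∈ B', ∀ y ∈ B', ‖ξ' x - ξ' y‖ ≤ D') (hgap' : Λ * D' < g') (hℓ' : g' < (2 : ℝ) ^ (ℓ' + 3)) :
    ℓ + 1 ≤ ℓ' := by
  -- transport `B` to `ξ'`, compare its gap with the diameter of `B'`
  obtain ⟨_, hg₁⟩ := controlled_transport hμ hD hg
  have hgD' : g - 2 * μ ≤ D' := gap_le_diam_of_ssubset hBB' hB hg₁ hD'
  have hD'0 : 0 ≤ D' := by
    obtain ⟨x, hx⟩ := hB
    exact (norm_nonneg _).trans (hD' x (hBB'.1 hx) x (hBB'.1 hx))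
  -- `2^ℓ (1 - 1/8) ≤ D' < g'/Λ ≤ 2^{ℓ'+3}/32 = 2^ℓ'/4`
  have h1 : (2 : ℝ) ^ ℓ * (7 / 8) ≤ D' := by linarith
  have h2 : Λ * D' < (2 : ℝ) ^ (ℓ' + 3) := hgap'.trans hℓ'
  have h3 : 32 * D' ≤ Λ * D' := mul_le_mul_of_nonneg_right hΛ hD'0
  have h4 : (2 : ℝ) ^ ℓ * 28 < (2 : ℝ) ^ (ℓ' + 3) := by linarith
  have h5 : (2 : ℝ) ^ (ℓ + 1) < (2 : ℝ) ^ ℓ' := by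
    have : (2 : ℝ) ^ (ℓ' + 3) = 2 ^ ℓ' * 8 := by ring
    rw [this] at h4
    have : (2 : ℝ) ^ (ℓ + 1) = 2 ^ ℓ * 2 := by ring
    rw [this]
    linarith [pow_pos (by norm_num : (0 : ℝ) < 2) ℓ]
  by_contra hlt
  push Not at hlt
  have : (2 : ℝ) ^ ℓ' ≤ 2 ^ (ℓ + 1) := pow_le_pow_right₀ (by norm_num) (by omega)
  linarith

/-- **Alive nodes stay `1`-gapped.** A `(D, g)`-controlled `Λ`-gapped set (`Λ ≥ 32`) remains, after a motion `≤ μ ≤ g/16` per body,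
`(D + 2μ, g − 2μ)`-controlled with `1·(D + 2μ) < g − 2μ`. [folklore] -/
theorem oneGapped_transport {ξ ξ' : ι → E3} {μ : ℝ} (hμ : ∀ x, ‖ξ' x - ξ x‖ ≤ μ) {B : Finset ι} {D g Λ : ℝ} (hΛ : 32 ≤ Λ)
    (hD : ∀ x ∈ B, ∀ y ∈ B, ‖ξ x - ξ y‖ ≤ D) (hg : ∀ x ∈ B, ∀ z ∈ univ \ B, g ≤ ‖ξ x - ξ z‖) (hgap : Λ * D < g)
    (hg0 : 0 ≤ g) (hμg : μ ≤ g / 16) :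
    (∀ x ∈ B, ∀ y ∈ B, ‖ξ' x - ξ' y‖ ≤ D + 2 * μ) ∧ (∀ x ∈ B, ∀ z ∈ univ \ B, g - 2 * μ ≤ ‖ξ' x - ξ' z‖) ∧
      1 * (D + 2 * μ) < g - 2 * μ := by
  obtain ⟨h1, h2⟩ := controlled_transport hμ hD hg
  refine ⟨h1, h2, ?_⟩
  by_cases hB : B.Nonempty
  · have hD0 : 0 ≤ D := by
      obtain ⟨x, hx⟩ := hB
      exact (norm_nonneg _).trans (hD x hx x hx)
    have : 32 * D ≤ Λ * D := mul_le_mul_of_nonneg_right hΛ hD0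
    -- `D < g/32`, `4μ ≤ g/4`
    nlinarith
  · -- empty `B`: only the inequality of numbers is asked; `D` may be anything, but `ΛD < g` with `Λ ≥ 32 > 1`… use it via cases on sign
    rcases le_or_gt 0 D with hD0 | hD0
    · have : 32 * D ≤ Λ * D := mul_le_mul_of_nonneg_right hΛ hD0
      nlinarith
    · nlinarith

/-- **The ball superset qualifies at its own level.** In the configuration `ξ` let `Bb` have internal distances `< 2r` and external
distances `≥ G₀` with `(4Λ+1) r ≤ G₀`, `0 < r`, `1 ≤ Λ`, and a pair `(x₀, z₀)` with `‖ξ x₀ − ξ z₀‖ ≤ G₀` (in the application the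
cross pair attaining the gap). Let `ℓ⋆` satisfy `2^{ℓ⋆+1} ≤ G₀ < 2^{ℓ⋆+2}` and let the bodies move by at most
`μ ≤ δ₁ G₀ / 2` with `δ₁ (Λ + 1) ≤ 1/4` to the configuration `ξ⋆`. Then in `ξ⋆` the set `Bb` is `(2r + 2μ, G₀ − 2μ)`-controlled,
`Λ (2r + 2μ) < G₀ − 2μ`, the pair is at distance `< 2 (G₀ − 2μ)`, and `2^{ℓ⋆} ≤ G₀ − 2μ < 2^{ℓ⋆+3}`. [folklore] -/
theorem ball_qualifies {ξ ξs : ι → E3} {μ : ℝ} (hμ : ∀ x, ‖ξs x - ξ x‖ ≤ μ) {Bb : Finset ι} {r G₀ Λ δ₁ : ℝ} {ℓs : ℕ}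
    (hΛ : 1 ≤ Λ) (hr : 0 < r) (hδ₁Λ : δ₁ * (Λ + 1) ≤ 1 / 4)
    (hint : ∀ x ∈ Bb, ∀ y ∈ Bb, ‖ξ x - ξ y‖ < 2 * r) (hext : ∀ x ∈ Bb, ∀ z ∈ univ \ Bb, G₀ ≤ ‖ξ x - ξ z‖)
    (hG₀ : (4 * Λ + 1) * r ≤ G₀) {x₀ z₀ : ι} (hnear : ‖ξ x₀ - ξ z₀‖ ≤ G₀)
    (hlev : (2 : ℝ) ^ (ℓs + 1) ≤ G₀) (hlev' : G₀ < (2 : ℝ) ^ (ℓs + 2)) (hμG : μ ≤ δ₁ * G₀ / 2) :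
    (∀ x ∈ Bb, ∀ y ∈ Bb, ‖ξs x - ξs y‖ ≤ 2 * r + 2 * μ) ∧ (∀ x ∈ Bb, ∀ z ∈ univ \ Bb, G₀ - 2 * μ ≤ ‖ξs x - ξs z‖) ∧
      Λ * (2 * r + 2 * μ) < G₀ - 2 * μ ∧ ‖ξs x₀ - ξs z₀‖ < 2 * (G₀ - 2 * μ) ∧
      (2 : ℝ) ^ ℓs ≤ G₀ - 2 * μ ∧ G₀ - 2 * μ < (2 : ℝ) ^ (ℓs + 3) := by
  obtain ⟨h1, h2⟩ := controlled_transport hμ (fun x hx y hy ↦ (hint x hx y hy).le) hext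
  have hG₀0 : 0 < G₀ := by nlinarith
  have hμ0 : 0 ≤ μ := (norm_nonneg _).trans (hμ x₀)
  have hδG : δ₁ * G₀ * (Λ + 1) ≤ G₀ / 4 := by nlinarith
  refine ⟨h1, h2, ?_, ?_, ?_, ?_⟩
  · -- `Λ(2r + 2μ) + 2μ ≤ 2Λr + (Λ+1) δ₁ G₀ ≤ 2Λ r + G₀/4 < G₀` since `G₀ ≥ (4Λ+1) r > (8/3)·… `; concretely `2Λ r ≤ (2Λ/(4Λ+1)) G₀ ≤ G₀/2`
    have hr' : 2 * Λ * r ≤ G₀ / 2 := by nlinarith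
    nlinarith
  · have h' := abs_dist_sub_dist_le_of_move hμ x₀ z₀
    rw [abs_le] at h'
    have hμG' : 6 * μ < G₀ := by nlinarith
    linarith
  · have : (2 : ℝ) ^ (ℓs + 1) = 2 ^ ℓs * 2 := by ring
    nlinarith [pow_pos (by norm_num : (0 : ℝ) < 2) ℓs]
  · have : (2 : ℝ) ^ (ℓs + 3) = 2 ^ (ℓs + 2) * 2 := by ring
    nlinarith [pow_pos (by norm_num : (0 : ℝ) < 2) (ℓs + 2)]

/-! ### Rest-mass centres -/

omit [DecidableEq ι] [Fintype ι] in
/-- A weighted average with nonnegative weights summing to `1` of points within `D` of `Y` is within `D` of `Y`. [folklore] -/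
theorem norm_weightedAvg_sub_le {ξ : ι → E3} {w : ι → ℝ} {A : Finset ι} {Y : E3} {D : ℝ}
    (hw : ∀ i ∈ A, 0 ≤ w i) (hsum : ∑ i ∈ A, w i = 1) (hb : ∀ i ∈ A, ‖ξ i - Y‖ ≤ D) :
    ‖∑ i ∈ A, w i • ξ i - Y‖ ≤ D := by
  have hrepr : ∑ i ∈ A, w i • ξ i - Y = ∑ i ∈ A, w i • (ξ i - Y) := by
    conv_lhs => rw [← one_smul ℝ Y, ← hsum, Finset.sum_smul, ← Finset.sum_sub_distrib]
    refine Finset.sum_congr rfl fun i _ ↦ ?_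
    rw [smul_sub]
  rw [hrepr]
  calc ‖∑ i ∈ A, w i • (ξ i - Y)‖ ≤ ∑ i ∈ A, ‖w i • (ξ i - Y)‖ := norm_sum_le _ _
    _ ≤ ∑ i ∈ A, w i * D := Finset.sum_le_sum fun i hi ↦ by
        rw [norm_smul, Real.norm_eq_abs, abs_of_nonneg (hw i hi)]
        exact mul_le_mul_of_nonneg_left (hb i hi) (hw i hi)
    _ = D := by rw [← Finset.sum_mul, hsum, one_mul]

omit [DecidableEq ι] [Fintype ι] in
/-- The rest-mass centre as a weighted average with weights `M_A⁻¹ Mᵢ`. [folklore] -/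
theorem centre_eq_sum_smul {ξ : ι → E3} {M : ι → ℝ} (A : Finset ι) :
    (∑ i ∈ A, M i)⁻¹ • ∑ i ∈ A, M i • ξ i = ∑ i ∈ A, ((∑ i ∈ A, M i)⁻¹ * M i) • ξ i := by
  rw [Finset.smul_sum]
  refine Finset.sum_congr rfl fun i _ ↦ ?_
  rw [smul_smul]

omit [DecidableEq ι] [Fintype ι] in
/-- Every point within `D` of all members of a nonempty `A` (positive masses) is within `D` of the rest-mass centre of `A`; in the form:
if `‖ξ i − Y‖ ≤ D` for all `i ∈ A` then `‖X_A − Y‖ ≤ D`. [folklore] -/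
theorem norm_centre_sub_le {ξ : ι → E3} {M : ι → ℝ} {A : Finset ι} {Y : E3} {D : ℝ} (hM : ∀ i, 0 < M i)
    (hAne : A.Nonempty) (hb : ∀ i ∈ A, ‖ξ i - Y‖ ≤ D) :
    ‖(∑ i ∈ A, M i)⁻¹ • ∑ i ∈ A, M i • ξ i - Y‖ ≤ D := by
  have hMA : 0 < ∑ i ∈ A, M i := Finset.sum_pos (fun i _ ↦ hM i) hAne
  rw [centre_eq_sum_smul]
  refine norm_weightedAvg_sub_le (fun i _ ↦ mul_nonneg (inv_nonneg.mpr hMA.le) (hM i).le) ?_ hb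
  rw [← Finset.mul_sum, inv_mul_cancel₀ hMA.ne']

omit [DecidableEq ι] [Fintype ι] in
/-- **Centres of subfamilies are close.** If all pairwise distances in `S` are `≤ D` and `A, A′ ⊆ S` are nonempty with positive
masses, their rest-mass centres are within `D`. [folklore] -/
theorem norm_centre_sub_centre_le {ξ : ι → E3} {M : ι → ℝ} {S A A' : Finset ι} {D : ℝ} (hM : ∀ i, 0 < M i)
    (hA : A ⊆ S) (hA' : A' ⊆ S) (hAne : A.Nonempty) (hA'ne : A'.Nonempty)
    (hD : ∀ x ∈ S, ∀ y ∈ S, ‖ξ x - ξ y‖ ≤ D) :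
    ‖(∑ i ∈ A, M i)⁻¹ • ∑ i ∈ A, M i • ξ i - (∑ i ∈ A', M i)⁻¹ • ∑ i ∈ A', M i • ξ i‖ ≤ D := by
  refine norm_centre_sub_le hM hAne fun i hi ↦ ?_
  -- `ξ i` is within `D` of the centre of `A'`
  have h := norm_centre_sub_le (ξ := ξ) (M := M) (A := A') (Y := ξ i) (D := D) hM hA'ne
    fun k hk ↦ hD k (hA' hk) i (hA hi)
  rwa [norm_sub_rev] at h

omit [DecidableEq ι] [Fintype ι] in
/-- The rest-mass centre of a singleton is the body itself. [folklore] -/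
theorem centre_singleton {ξ : ι → E3} {M : ι → ℝ} (hM : ∀ i, 0 < M i) (j : ι) :
    (∑ i ∈ ({j} : Finset ι), M i)⁻¹ • ∑ i ∈ ({j} : Finset ι), M i • ξ i = ξ j := by
  rw [Finset.sum_singleton, Finset.sum_singleton, smul_smul, inv_mul_cancel₀ (hM j).ne', one_smul]

omit [DecidableEq ι] [Fintype ι] in
/-- Every member of `S` is within the diameter bound of the rest-mass centre of any nonempty subfamily. [folklore] -/
theorem norm_sub_centre_le {ξ : ι → E3} {M : ι → ℝ} {S A : Finset ι} {D : ℝ} (hM : ∀ i, 0 < M i)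
    (hA : A ⊆ S) (hAne : A.Nonempty) {x : ι} (hx : x ∈ S) (hD : ∀ x ∈ S, ∀ y ∈ S, ‖ξ x - ξ y‖ ≤ D) :
    ‖ξ x - (∑ i ∈ A, M i)⁻¹ • ∑ i ∈ A, M i • ξ i‖ ≤ D := by
  have h := norm_centre_sub_le (ξ := ξ) (M := M) (A := A) (Y := ξ x) (D := D) hM hAne
    fun k hk ↦ hD k (hA hk) x hx
  rwa [norm_sub_rev] at h

/-- Registered one-line form of `level_succ_le_of_ssubset` (strict superset nodes live at strictly coarser levels). [folklore] -/
theorem level_succ_le_of_ssubset_node : open Literature.Geometry.Lorentzian Finset in ∀ {ι : Type*} [DecidableEq ι] [Fintype ι] {ξ ξ' : ι → E3} {μ : ℝ}, (∀ x, ‖ξ' x - ξ x‖ ≤ μ) → ∀ {B B' : Finset ι} {D g D' g' Λ : ℝ} {ℓ ℓ' : ℕ}, 32 ≤ Λ → B.Nonempty → B ⊂ B' → (∀ x ∈ B, ∀ y ∈ B, ‖ξ x - ξ y‖ ≤ D) → (∀ x ∈ B, ∀ z ∈ univ \ B, g ≤ ‖ξ x - ξ z‖) → (2 : ℝ) ^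 ℓ ≤ g → μ ≤ (2 : ℝ) ^ ℓ / 16 → (∀ x ∈ B', ∀ y ∈ B', ‖ξ' x - ξ' y‖ ≤ D') → Λ * D' < g' → g' < (2 : ℝ) ^ (ℓ' + 3) → ℓ + 1 ≤ ℓ' :=
  fun hμ _ _ _ _ _ _ _ _ _ hΛ hB hBB' hD hg hℓ hμℓ hD' hgap' hℓ' ↦ level_succ_le_of_ssubset hμ hΛ hB hBB' hD hg hℓ hμℓ hD' hgap' hℓ'

end Summit.FinalStateConjecture.FinalStateConjecture.Theorems.SublinearIsFree.Virial

end
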